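import Summits.QuantumAdvantage.QuantumAdvantage.Theorems.CubicForrelationNearExactIsExactTwelveWindowHyperplane
import Literature.Computability.QuantumComplexity.ForrelationDirectSum

/-!
# Crux `CubicForrelation.NearExactIsExact` (stmt-QuantumAdvantage-14043) — n = 12 window `(59/64, 1)`: the pairing identity for the
  sign pattern of a quadratic on an affine hyperplane

Certificate seat `b2b-cforr-cert` (gen 14).  HONEST FRAMING: lemmas (standard axioms) for the theorem `θ₁₂ ≤ 59/64`
(`…TwelveWindow5964.lean`): finite Fourier bookkeeping on `𝔽₂¹²`, NOT summit progress.

Setting: an affine hyperplane `P = {x : (−1)^{γ·x} = t}` (`t = ±1`) with direction space `V = {a : (−1)^{γ·a} = 1}`, a Boolean `D` of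
degree `≤ 2`, `σ = (−1)^D`, and the relative transform `S(z) := Σ_{x∈P} σ(x)(−1)^{x·z}`.
* `tw59_pairing`: `S(z)·S(z') = Σ_{a∈V} (−1)^{a·z'} Σ_{x∈P} σ(x)σ(x⊕a)(−1)^{x·(z⊕z')}` (reindex `x' = x ⊕ a`);
* `tw59_hyperplane_charsum`: a character sums to `0` over `P` unless it is constant on `P`;
* `tw59_inner_dichotomy`: since `D(x) ⊕ D(x⊕a)` is affine (`stub_derivDegree`, `stub_affineForm`), each inner sum is `0` unless its
  summand is CONSTANT on `P`;
* `tw59_pairing_ne_zero`: hence `S(z)S(z') ≠ 0` forces some `a ∈ V` with `σ(x)σ(x⊕a)(−1)^{x·(z⊕z')}` constant on `P`;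
* `tw59_translate`: and for such `a` (constant `κ`), `S(w ⊕ z ⊕ z') = κ·(−1)^{a·w}·S(w)` for EVERY `w` — so `|S|` is constant on its
  support and the sign of `S` changes affinely under translations (the two facts that replace "plateau" and "the dual of a bent
  quadratic is quadratic" in the window theorem).

References: C. Carlet, *Boolean Functions for Cryptography and Coding Theory* (CUP 2021) §2.3, §5.1 (quadratic functions);
F. J. MacWilliams, N. J. A. Sloane (1977) Ch. 15.  Everything below is proved from Mathlib and the tree.
-/

set_option linter.dupNamespace false -- D-0017: single-problem summit ⇒ `QuantumAdvantage.QuantumAdvantage` by design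

noncomputable section

namespace Summit.QuantumAdvantage.QuantumAdvantage.Theorems.CubicForrelation.NearExactIsExact

open Finset
open Literature.Computability.QuantumComplexity
open Literature.Computability.QuantumComplexity.BuzetChailloux (bxor zeroVec bxor_bxor_cancel_left bxor_zeroVec zeroVec_bxor bxor_comm
  bxor_self twist_zeroVec_right twist_bxor_right signOf_sq)
open Literature.Computability.QuantumComplexity.Simon (twist_eq_one_or)
open Literature.Computability.QuantumComplexity.DerivativeWalsh (W twist_bxor_left)

/-! ### The hyperplane, its direction space, translations -/

/-- Right cancellation `(x ⊕ a) ⊕ a = x`. [folklore] -/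
theorem tw59_bxor_cancel_right (x a : Fin (6 + 6) → Bool) : bxor (bxor x a) a = x := by
  rw [bxor_comm (bxor x a) a, bxor_comm x a, bxor_bxor_cancel_left]

/-- Translating a point of `P = {(−1)^{γ·x} = t}` by a direction `a` (`(−1)^{γ·a} = 1`) stays in `P`. [folklore] -/
theorem tw59_mem_translate {γ a x : Fin (6 + 6) → Bool} {t : ℝ} (ha : twist γ a = 1) (hx : twist γ x = t) :
    twist γ (bxor x a) = t := by
  rw [twist_bxor_right, hx, ha, mul_one]

/-- Reindexing a sum over `P` by the translation `x ↦ x ⊕ a`, `a` a direction of `P`. [folklore] -/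
theorem tw59_sum_translate (P : Finset (Fin (6 + 6) → Bool)) (γ : Fin (6 + 6) → Bool) (t : ℝ)
    (hP : ∀ x, x ∈ P ↔ twist γ x = t) (a : Fin (6 + 6) → Bool) (ha : twist γ a = 1) (F : (Fin (6 + 6) → Bool) → ℝ) :
    ∑ x ∈ P, F (bxor x a) = ∑ x ∈ P, F x := by
  refine sum_nbij' (fun x => bxor x a) (fun x => bxor x a) (fun x hx => ?_) (fun x hx => ?_) (fun x _ => tw59_bxor_cancel_right x a)
    (fun x _ => tw59_bxor_cancel_right x a) (fun x _ => rfl)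
  · exact (hP _).2 (tw59_mem_translate ha ((hP x).1 hx))
  · exact (hP _).2 (tw59_mem_translate ha ((hP x).1 hx))

/-- For `x ∈ P`, the hyperplane is the translate of its direction space: `P = x ⊕ V`. [folklore] -/
theorem tw59_eq_image (P V : Finset (Fin (6 + 6) → Bool)) (γ : Fin (6 + 6) → Bool) (t : ℝ)
    (hP : ∀ x, x ∈ P ↔ twist γ x = t) (hV : ∀ a, a ∈ V ↔ twist γ a = 1) (x : Fin (6 + 6) → Bool) (hx : x ∈ P) :
    P = V.image (bxor x) := by
  ext y
  rw [mem_image, hP]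
  constructor
  · intro hy
    refine ⟨bxor x y, (hV _).2 ?_, bxor_bxor_cancel_left x y⟩
    have htx := (hP x).1 hx
    have h := twist_bxor_right γ x y
    rw [htx, hy] at h
    rw [h]
    have ht : t = 1 ∨ t = -1 := by rw [← htx]; exact twist_eq_one_or γ x
    rcases ht with h1 | h1 <;> rw [h1] <;> norm_num
  · rintro ⟨a, ha, rfl⟩
    exact tw59_mem_translate ((hV a).1 ha) ((hP x).1 hx)

/-! ### The pairing identity -/

/-- **Pairing identity.**  For the relative transform `S(z) = Σ_{x∈P} σ(x)(−1)^{x·z}` of ANY real `σ`: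
`S(z)·S(z') = Σ_{a∈V} (−1)^{a·z'} · Σ_{x∈P} σ(x)σ(x⊕a)(−1)^{x·(z⊕z')}` (substitute `x' = x ⊕ a`). [folklore] -/
theorem tw59_pairing (P V : Finset (Fin (6 + 6) → Bool)) (γ : Fin (6 + 6) → Bool) (t : ℝ)
    (hP : ∀ x, x ∈ P ↔ twist γ x = t) (hV : ∀ a, a ∈ V ↔ twist γ a = 1) (σ : (Fin (6 + 6) → Bool) → ℝ)
    (z z' : Fin (6 + 6) → Bool) :
    (∑ x ∈ P, σ x * twist x z) * (∑ x ∈ P, σ x * twist x z') =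
      ∑ a ∈ V, twist a z' * ∑ x ∈ P, σ x * σ (bxor x a) * twist x (bxor z z') := by
  rw [sum_mul_sum]
  have hinner : ∀ x ∈ P, ∑ x' ∈ P, σ x * twist x z * (σ x' * twist x' z') =
      ∑ a ∈ V, twist a z' * (σ x * σ (bxor x a) * twist x (bxor z z')) := by
    intro x hx
    rw [tw59_eq_image P V γ t hP hV x hx, sum_image fun a _ b _ hab => by
      simpa only [bxor_bxor_cancel_left] using congrArg (bxor x) hab]
    refine sum_congr rfl fun a _ => ?_
    rw [twist_bxor_left, twist_bxor_right]
    ring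
  rw [sum_congr rfl hinner, sum_comm]
  refine sum_congr rfl fun a _ => ?_
  rw [mul_sum]

/-- **Character sums over a hyperplane.**  For `P = {(−1)^{γ·x} = t}` (`γ ≠ 0`, `t = ±1`) and any `v`: either `Σ_{x∈P} (−1)^{x·v} = 0`,
or the character `(−1)^{x·v}` is constant on `P` (the cases `v ∈ {0, γ}`). [folklore] -/
theorem tw59_hyperplane_charsum (P : Finset (Fin (6 + 6) → Bool)) (γ : Fin (6 + 6) → Bool) (t : ℝ) (ht : t = 1 ∨ t = -1)
    (hP : ∀ x, x ∈ P ↔ twist γ x = t) (v : Fin (6 + 6) → Bool) :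
    (∑ x ∈ P, twist x v = 0) ∨ (∀ x ∈ P, ∀ x' ∈ P, twist x v = twist x' v) := by
  by_cases hv0 : v = zeroVec
  · right; intro x _ x' _; rw [hv0, twist_zeroVec_right, twist_zeroVec_right]
  by_cases hvγ : v = γ
  · right; intro x hx x' hx'
    rw [hvγ, twist_comm x γ, twist_comm x' γ, (hP x).1 hx, (hP x').1 hx']
  left
  -- `[x ∈ P] = (1 + t(−1)^{γ·x})/2`
  have hind : ∀ x : Fin (6 + 6) → Bool, (if x ∈ P then twist x v else 0) = (1 + t * twist γ x) / 2 * twist x v := by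
    intro x
    by_cases hx : x ∈ P
    · rw [if_pos hx, (hP x).1 hx]
      rcases ht with h | h <;> rw [h] <;> ring
    · rw [if_neg hx]
      have hne : twist γ x ≠ t := fun h => hx ((hP x).2 h)
      have hm : t * twist γ x = -1 := by
        rcases twist_eq_one_or γ x with hc | hc
        · rcases ht with rfl | rfl
          · exact absurd hc hne
          · rw [hc]; norm_num
        · rcases ht with rfl | rfl
          · rw [hc]; norm_num
          · exact absurd hc hne
      rw [hm]; ring
  have hfil : ∑ x ∈ P, twist x v = ∑ x, (if x ∈ P then twist x v else 0) := by
    rw [← sum_filter]; congr 1; ext x; simp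
  rw [hfil, sum_congr rfl fun x _ => hind x]
  have e : ∀ x : Fin (6 + 6) → Bool, (1 + t * twist γ x) / 2 * twist x v = (1 / 2) * twist x v + (t / 2) * twist x (bxor γ v) := by
    intro x; rw [twist_bxor_right, twist_comm x γ]; ring
  have hv0' : ¬ v = (fun _ => false) := hv0
  have hvγ' : ¬ bxor γ v = (fun _ => false) := fun h =>
    hvγ ((Literature.Computability.QuantumComplexity.BuzetChailloux.bxor_eq_zeroVec_iff γ v).1 h).symm
  rw [sum_congr rfl fun x _ => e x, sum_add_distrib, ← mul_sum, ← mul_sum, tz_sum_twist_left, tz_sum_twist_left,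
    if_neg hv0', if_neg hvγ', mul_zero, mul_zero, add_zero]

/-- **Inner-sum dichotomy.**  For `D` of degree `≤ 2` and any `a, m`: the summand `σ(x)σ(x⊕a)(−1)^{x·m}` (`σ = (−1)^D`) is an
affine character (`stub_derivDegree`, `stub_affineForm`), so either its sum over the hyperplane `P` vanishes or it is constant on `P`.
[this work] -/
theorem tw59_inner_dichotomy (P : Finset (Fin (6 + 6) → Bool)) (γ : Fin (6 + 6) → Bool) (t : ℝ) (ht : t = 1 ∨ t = -1)
    (hP : ∀ x, x ∈ P ↔ twist γ x = t) (D : (Fin (6 + 6) → Bool) → Bool) (hD : IsDegLeFun 2 D) (a m : Fin (6 + 6) → Bool) :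
    (∑ x ∈ P, signOf (D x) * signOf (D (bxor x a)) * twist x m = 0) ∨
      (∀ x ∈ P, ∀ x' ∈ P, signOf (D x) * signOf (D (bxor x a)) * twist x m = signOf (D x') * signOf (D (bxor x' a)) * twist x' m) := by
  have hdeg : IsDegLeFun 1 (fun x => D x ^^ D (bxor x a)) := stub_derivDegree (6 + 6) 1 D a hD
  obtain ⟨c, b, hcb⟩ := stub_affineForm (6 + 6) _ hdeg
  have hterm : ∀ x : Fin (6 + 6) → Bool, signOf (D x) * signOf (D (bxor x a)) * twist x m = signOf b * twist x (bxor c m) := by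
    intro x
    rw [← signOf_xor, hcb x, twist_bxor_right, twist_comm c x]; ring
  simp_rw [hterm]
  rcases tw59_hyperplane_charsum P γ t ht hP (bxor c m) with h | h
  · left; rw [← mul_sum, h, mul_zero]
  · right; intro x hx x' hx'; rw [h x hx x' hx']

/-- **Non-vanishing products locate a direction.**  If `S(z)S(z') ≠ 0` then some direction `a ∈ V` makes `σ(x)σ(x⊕a)(−1)^{x·(z⊕z')}`
constant on `P`. [this work] -/
theorem tw59_pairing_ne_zero (P V : Finset (Fin (6 + 6) → Bool)) (γ : Fin (6 + 6) → Bool) (t : ℝ) (ht : t = 1 ∨ t = -1)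
    (hP : ∀ x, x ∈ P ↔ twist γ x = t) (hV : ∀ a, a ∈ V ↔ twist γ a = 1) (D : (Fin (6 + 6) → Bool) → Bool) (hD : IsDegLeFun 2 D)
    (z z' : Fin (6 + 6) → Bool)
    (hne : (∑ x ∈ P, signOf (D x) * twist x z) * (∑ x ∈ P, signOf (D x) * twist x z') ≠ 0) :
    ∃ a, twist γ a = 1 ∧ ∃ κ : ℝ, ∀ x ∈ P, signOf (D x) * signOf (D (bxor x a)) * twist x (bxor z z') = κ := by
  by_contra hnone
  push Not at hnone
  apply hne
  rw [tw59_pairing P V γ t hP hV (fun x => signOf (D x)) z z']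
  refine sum_eq_zero fun a ha => ?_
  rcases tw59_inner_dichotomy P γ t ht hP D hD a (bxor z z') with h | h
  · rw [h, mul_zero]
  · exfalso
    by_cases hPe : P = ∅
    · apply hne; rw [hPe]; simp
    · obtain ⟨x₀, hx₀⟩ := nonempty_iff_ne_empty.2 hPe
      obtain ⟨x, hx, hxne⟩ := hnone a ((hV a).1 ha) (signOf (D x₀) * signOf (D (bxor x₀ a)) * twist x₀ (bxor z z'))
      exact hxne (h x hx x₀ hx₀)

/-- **Translation identity.**  If `a ∈ V` and `σ(x)σ(x⊕a)(−1)^{x·m} = κ` on `P`, then `S(w ⊕ m) = κ·(−1)^{a·w}·S(w)` for every `w`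
(substitute `x ↦ x ⊕ a` in the sum). [this work] -/
theorem tw59_translate (P : Finset (Fin (6 + 6) → Bool)) (γ : Fin (6 + 6) → Bool) (t : ℝ)
    (hP : ∀ x, x ∈ P ↔ twist γ x = t) (D : (Fin (6 + 6) → Bool) → Bool) (a m : Fin (6 + 6) → Bool) (ha : twist γ a = 1)
    (κ : ℝ) (hκ : ∀ x ∈ P, signOf (D x) * signOf (D (bxor x a)) * twist x m = κ) (w : Fin (6 + 6) → Bool) :
    ∑ x ∈ P, signOf (D x) * twist x (bxor w m) = κ * twist a w * ∑ x ∈ P, signOf (D x) * twist x w := by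
  have hpt : ∀ x ∈ P, signOf (D x) * twist x (bxor w m) = κ * (signOf (D (bxor x a)) * twist x w) := by
    intro x hx
    have h := hκ x hx
    have hs : signOf (D (bxor x a)) * signOf (D (bxor x a)) = 1 := by rw [← sq, signOf_sq]
    rw [twist_bxor_right, ← h]
    linear_combination (-(signOf (D x) * twist x w * twist x m)) * hs
  rw [sum_congr rfl hpt, ← mul_sum]
  have hre := tw59_sum_translate P γ t hP a ha (fun x => signOf (D x) * twist (bxor x a) w)
  have e2 : ∀ x, signOf (D x) * twist (bxor x a) w = twist a w * (signOf (D x) * twist x w) := by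
    intro x; rw [twist_bxor_left]; ring
  have hre' : ∑ x ∈ P, signOf (D (bxor x a)) * twist x w = twist a w * ∑ x ∈ P, signOf (D x) * twist x w := by
    have h3 : ∀ x ∈ P, signOf (D (bxor x a)) * twist x w = (fun y => signOf (D y) * twist (bxor y a) w) (bxor x a) := by
      intro x _
      simp only [tw59_bxor_cancel_right]
    rw [sum_congr rfl h3, hre, sum_congr rfl fun x _ => e2 x, ← mul_sum]
  rw [hre']
  ring

end Summit.QuantumAdvantage.QuantumAdvantage.Theorems.CubicForrelation.NearExactIsExact

end
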